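/-
Copyright (c) 2026 the pub-hodgecm-mathlib formalisation cell (harness21).  Prover seat hodgecm-mathlib-F0P2-p06 (g12): road «S3-ram» (LEAD F0P3a-plan (g12); architect
A-p16 (g31); owner F0P3a-p06 (g15)), organ A′ (ii) (B4) «LOCAL LAW AT A GENERAL FIXED VERTEX», ROOTED FORM G3⁺ — the multiplicity binders of F0P3a-p01 (g16)'s
tree-induction engine (G5); 2026-09-01.
-/
import Literature.NumberTheory.Automorphic.UnitaryLatticeTreeFixedChildCountTransportRamified   -- ★ p847251 (this seat): G3, the fixed-child count at a general vertex `u·L₀`, «one fixed ⇒ all fixed»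
import Literature.NumberTheory.Automorphic.UnitaryLatticeTreeSelfDualTransitiveTame              -- ★ `exists_latticeGraphIso_root_eq_of_v_two` (every self-dual vertex is `u·L₀`)
import Literature.NumberTheory.Automorphic.UnitaryLatticeTreeLevelShift                          -- ★ `map_sub_one_latt_le_scaleLattice_iff` (the LEVEL token in a basis)
import Literature.NumberTheory.Automorphic.UnitaryLatticeTreeStabilizer                          -- ★ `mapGL_stdLattice_eq_iff` (the stabiliser of the root)
import Literature.NumberTheory.Automorphic.UnitaryLatticeTreeStarOfInvolution                    -- ★ `not_isSelfDualLattice_of_isVertexLattice_two_of_v`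
import Literature.Combinatorics.SimpleGraph.TreeDescendantPartition                               -- ★ G1 p847239 (F0P2-p02 (g13)): `exists_rooted_parent`, `parentClosed_fixedPoints`
import HarnessLib

/-!
# The lattice graph of a hermitian space — THE FIXED GRANDCHILDREN OF A FIXED SELF-DUAL VERTEX in the rooted tame-ramified `U(3)` tree: `#GC(v) = q · #{children of v
# passing the residual test}`, `= q²` two levels deep, and «the inward neighbour always passes» (Bruhat–Tits 1972 §10; Tits 1979 §3.5; Serre, *Trees* I.2.3, II.1.1;
# Kottwitz 1986 §3)

Topic `NumberTheory/Automorphic`; namespace `Literature.NumberTheory.Automorphic.UnitaryLatticeTree`.  THEOREMS ONLY (no definition, no instance, no notation, no named fact,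
no `sorry`); kernel lane `--supports stmt-HodgeConjecture-24833`.  Cell `pub/hodgecm-mathlib` (D-0151), crux H413; road «S3-ram» (Literature seeding), organ A′ (ii) of the
P-1-ram skeleton (architect A-p16 (g31)), gap G3 = (B4) of the blueprint «(a2)(B) TREE INDUCTION» (F0P3a-p01 (g16)), ROOTED FORM: the tree-induction engine
`strataVec_cone_eq_of_localLaw` (F0P3a-p01) runs on the lattice graph `G` ROOTED at `r = L₀ = 𝒪³` with the fixed set `F = {x | γ·x = x}` of `γ ∈ K₀` and consumes, at
every fixed self-dual vertex `v ≠ r`, the set of FIXED GRANDCHILDREN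
  `GC(v) = {w | ∃ c, (v ~ c ∧ dist(r,c) = dist(r,v) + 1 ∧ γ·c = c) ∧ (c ~ w ∧ dist(r,w) = dist(r,c) + 1 ∧ γ·w = w)}`
(its binder `hGC` VERBATIM, with `F` the fixed set of the graph automorphism `latticeGraphIso γ`).  This file computes `#GC(v)` from the star-level law ★
`UnitaryLatticeTreeFixedChildCountTransportRamified` (G3) and the rooted-tree bookkeeping ★ `TreeDescendantPartition` (G1): the tree property is a BINDER `hT` (★
`isTree_latticeGraph_three_of_neg` ∕ `…_of_frames` discharge it), DATUM-FREE ramified tokens as in G3.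

THE MATHEMATICS.  `v = u·L₀` (★ transitivity), `γ′ = u⁻¹γu ∈ K₀` (since `γ` fixes `v`, §1), and the depth token `(γ − 1)·v ⊆ ϖ·v` of the (a2) label sheet reads
`γ′ ≡ 1 (mod ϖ)` (★ `map_sub_one_latt_le_scaleLattice_iff`, §1).  In the rooted tree the CHILDREN of `v` (neighbours one step further from `r`) are its modular
neighbours `(uκ)·N₁` other than the parent; all of them are fixed (★ G3 §3); through a child `c` the vertices one step further are the self-dual `w ~ c`, `w ≠ v`, and
the fixed ones number `q·[c passes]`, where «`c` PASSES» ⟺ every neighbour of `c` is fixed ⟺ the residual test `|ϖ⁻¹B₀(κe₀,(γ′−1)κe₀)| < 1` (★ G3 §3–§4; §2 here).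
Summing over the (pairwise disjoint) slices: **`#GC(v) = q · #{children passing}`** (§3); two levels deep (`(γ − 1)·v ⊆ ϖ²·v`) every child passes and **`#GC(v) = q²`**
(§3); and since the grand-parent of `v` is fixed (★ `parentClosed_fixedPoints`), THE PARENT ALWAYS PASSES: **`#{children passing} + 1 = #{neighbours passing}`** (§4) —
the blueprint's «inward isotropic line is `Q_Ȳ`-null», leaving the residual evaluation `#{neighbours passing} ∈ {q+1, 2, 1}` (by the `O(J₀)`-type of `Ȳ`; ★
`OrthogonalThreeIsotropicPointsNilpotentForm`) to the ν-bridge organ.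

* §1 `mem_unitaryInt_conj_of_latticeGraphIso_apply_root_eq` (`γ·(u·L₀) = u·L₀ ⇒ u⁻¹γu ∈ K₀`), `forall_v_conj_sub_one_le_of_map_sub_one_le_scaleLattice` (the LEVEL token at
  `u·L₀` ⇒ `u⁻¹γu ≡ 1 (mod c)` entrywise), `latticeGraphIso_eq_iff_mapGL_eq` (vertex ∕ lattice spelling of fixedness).
* §2 `forall_fixed_neighbor_iff_v_B₀_lt_one_of_congr` («`c` passes ⟺ the residual test»), **`ncard_fixed_farther_neighbors_eq_ite_of_congr`** (the slice through a child:
  `#{w ~ c | dist(r,w) = dist(r,c)+1, γ·w = w} = if c passes then q else 0`).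
* §3 **`ncard_fixedGrandchildren_eq_mul_ncard_passingChildren`** (`#GC(v) = q · #{children passing}`, hypotheses: `hT`, `v` self-dual `≠ r` fixed, LEVEL token `ϖ`),
  **`ncard_fixedGrandchildren_eq_sq_of_level_two`** (`= q²` under the LEVEL token `ϖ²`).
* §4 **`ncard_passingChildren_add_one_eq_ncard_passingNeighbors`** (the parent passes; `γ ∈ K₀`).

HONEST LABEL: HC_CM is proved only modulo the 2 remaining named inputs (hLiu418 24832, h413 24833) until rung 0 closes; nothing printed is asserted here (rooted-tree
bookkeeping over ★ results); «S3-ram» has no books consequence.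

## References
* [BruhatTits1972] F. Bruhat, J. Tits, *Groupes réductifs sur un corps local I*, Publ. Math. IHÉS 41 (1972), §10 (lattice models; stars are residual buildings).
* [Tits1979] J. Tits, *Reductive groups over local fields*, PSPM 33.1 (1979), §2.4 (ramified `U(3)`: local index `(q+1, q+1)`), §3.5 (congruence subgroups act trivially on stars).
* [Serre1980Trees] J.-P. Serre, *Trees* (1980), Ch. I §2.3 (rooted trees, geodesics), Ch. II §1.1 (neighbours of a lattice; fixed subtrees).
* [Kottwitz1986] R. E. Kottwitz, *Base change for unit elements of Hecke algebras*, Compositio Math. 60 (1986), §3 (counting fixed lattices shell by shell).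
-/

set_option autoImplicit false

noncomputable section

open scoped Valued WithZero Matrix MatrixGroups

namespace Literature.NumberTheory.Automorphic.UnitaryLatticeTree

open Literature.NumberTheory.Automorphic Literature.NumberTheory.Automorphic.HermitianLattice
open Literature.NumberTheory.Automorphic.CartanUnique
open Literature.Combinatorics.SimpleGraph.TreeLayers

variable {K : Type*} [Field K] [Valued K ℤᵐ⁰] {σ : K →+* K} {ϖ : K}

/-- The `ncard` of a finite pairwise-disjoint union indexed by a finset is the sum of the `ncard`s (folklore bookkeeping, as in ★ G1). [cite: Serre1980Trees, I.2.3] -/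
private theorem ncard_biUnion_finset_eq_sum_of_disjoint_G3 {ι α : Type*} [DecidableEq ι] (I : Finset ι) (S : ι → Set α)
    (hfin : ∀ i ∈ I, (S i).Finite) (hdisj : ∀ i ∈ I, ∀ j ∈ I, i ≠ j → Disjoint (S i) (S j)) :
    (⋃ i ∈ I, S i).ncard = ∑ i ∈ I, (S i).ncard := by
  induction I using Finset.induction_on with
  | empty => simp
  | insert a I haI ih =>
    have hfin' : ∀ i ∈ I, (S i).Finite := fun i hi => hfin i (Finset.mem_insert_of_mem hi)
    have hdisj' : ∀ i ∈ I, ∀ j ∈ I, i ≠ j → Disjoint (S i) (S j) := fun i hi j hj =>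
      hdisj i (Finset.mem_insert_of_mem hi) j (Finset.mem_insert_of_mem hj)
    rw [Finset.set_biUnion_insert, Finset.sum_insert haI, ← ih hfin' hdisj']
    refine Set.ncard_union_eq ?_ (hfin a (Finset.mem_insert_self a I)) (Set.Finite.biUnion I.finite_toSet hfin')
    rw [Set.disjoint_iUnion₂_right]
    exact fun i hi => hdisj a (Finset.mem_insert_self a I) i (Finset.mem_insert_of_mem hi) (fun h => haI (h ▸ hi))

/-! ## §1 Reading a fixed vertex `u·L₀` at the root: `u⁻¹γu ∈ K₀`, and the LEVEL token -/

/-- Vertex ∕ lattice spelling of fixedness: `latticeGraphIso γ x = x ↔ γ·x.1 = x.1`. [cite: BruhatTits1972, §10] -/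
theorem latticeGraphIso_eq_iff_mapGL_eq {N : ℕ} {H : Matrix (Fin N) (Fin N) K} (γ : unitaryGroupOfForm σ H)
    (x : {M : Submodule 𝒪[K] (Fin N → K) // IsVertex σ ϖ H M}) :
    latticeGraphIso σ ϖ H γ x = x ↔ mapGL (γ : GL (Fin N) K) x.1 = x.1 := by
  rw [← Subtype.coe_inj, latticeGraphIso_apply_val]

/-- **`γ` fixes `u·L₀` ⇒ `u⁻¹γu ∈ K₀`** (the stabiliser of the root is `K₀ = U ∩ GL₃(𝒪)`: ★ `mapGL_stdLattice_eq_iff`). [cite: BruhatTits1972, §10] [cite: Serre1980Trees, II.1.1] -/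
theorem mem_unitaryInt_conj_of_latticeGraphIso_apply_root_eq {N : ℕ} {H : Matrix (Fin N) (Fin N) K} {γ u : unitaryGroupOfForm σ H}
    {h0 : IsVertex σ ϖ H (stdLattice K N)}
    (hfix : latticeGraphIso σ ϖ H γ (latticeGraphIso σ ϖ H u ⟨stdLattice K N, h0⟩) = latticeGraphIso σ ϖ H u ⟨stdLattice K N, h0⟩) :
    u⁻¹ * γ * u ∈ unitaryInt σ H := by
  rw [latticeGraphIso_eq_iff_mapGL_eq, mapGL_latticeGraphIso_eq_iff] at hfix
  change mapGL ((u⁻¹ * γ * u : unitaryGroupOfForm σ H) : GL (Fin N) K) (stdLattice K N) = stdLattice K N at hfix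
  rw [mapGL_stdLattice_eq_iff] at hfix
  exact mem_unitaryInt_iff.2 ⟨hfix.1, hfix.2⟩

/-- **THE LEVEL TOKEN AT `u·L₀`**: `(γ − 1)·(u·L₀) ⊆ c·(u·L₀)` (`c ≠ 0`) iff `u⁻¹γu ≡ 1 (mod c)` entrywise (★ `map_sub_one_latt_le_scaleLattice_iff` with `u·L₀ = latt u`).
[cite: Kottwitz1986, §3] [cite: Serre1980Trees, II.1.1] -/
theorem forall_v_conj_sub_one_le_iff_map_sub_one_le_scaleLattice {N : ℕ} {H : Matrix (Fin N) (Fin N) K} (γ u : unitaryGroupOfForm σ H) {c : K} (hc : c ≠ 0) :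
    (mapGL (u : GL (Fin N) K) (stdLattice K N)).map ((Matrix.toLin' (((γ : GL (Fin N) K) : Matrix (Fin N) (Fin N) K) - 1)).restrictScalars 𝒪[K]) ≤
        scaleLattice c (mapGL (u : GL (Fin N) K) (stdLattice K N)) ↔
      ∀ i j, Valued.v (((((u⁻¹ * γ * u : unitaryGroupOfForm σ H) : GL (Fin N) K) : Matrix (Fin N) (Fin N) K) - 1) i j) ≤ Valued.v c := by
  have hrfl : mapGL (u : GL (Fin N) K) (stdLattice K N) = latt ((u : GL (Fin N) K) : Matrix (Fin N) (Fin N) K) := rfl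
  rw [hrfl, map_sub_one_latt_le_scaleLattice_iff hc, Subgroup.coe_mul, Subgroup.coe_mul, Subgroup.coe_inv]

/-! ## §2 The slice through a child: «passes» ⟺ the residual test, and its fixed count -/

section Three

/-- **«`c` PASSES» ⟺ THE RESIDUAL TEST**: for the modular neighbour `c = (uκ)·N₁` of `v = u·L₀` (`γ′ = u⁻¹γu ∈ K₀`, `≡ 1 (mod ϖ)`, `κ ∈ K₀`), every vertex adjacent to `c` is fixed
by `γ` iff `|ϖ⁻¹·B₀(x, (γ′−1)x)| < 1`, `x = κe₀` (★ G3 §3–§4: the count `q` is positive, and one fixed child forces the test). [cite: Tits1979, §3.5] [cite: Serre1980Trees, II.1.1] -/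
theorem forall_fixed_neighbor_iff_v_B₀_lt_one_of_congr (hvσ : ∀ a, Valued.v (σ a) = Valued.v a) (hσϖ : σ ϖ = -ϖ) (hϖ : Valued.v ϖ = WithZero.exp (-1 : ℤ))
    (hres : ∀ x : K, Valued.v x ≤ 1 → Valued.v (σ x - x) < 1) [Finite 𝓀[K]]
    {γ u κ : unitaryGroupOfForm σ ((StdForm.antidiagonal 3).over K)}
    (hγK : u⁻¹ * γ * u ∈ unitaryInt σ ((StdForm.antidiagonal 3).over K)) (hκK : κ ∈ unitaryInt σ ((StdForm.antidiagonal 3).over K))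
    (hγϖ : ∀ i j, Valued.v (((((u⁻¹ * γ * u : unitaryGroupOfForm σ ((StdForm.antidiagonal 3).over K)) : GL (Fin 3) K) : Matrix (Fin 3) (Fin 3) K) - 1) i j) ≤ Valued.v ϖ) :
    (∀ w ∈ (latticeGraph σ ϖ ((StdForm.antidiagonal 3).over K)).neighborSet
          (latticeGraphIso σ ϖ ((StdForm.antidiagonal 3).over K) (u * κ) ⟨latt (Matrix.diagonal ![(1 : K), 1, ϖ]), 2, isVertexLattice_two_N₁_of_neg hσϖ hϖ⟩),
        latticeGraphIso σ ϖ ((StdForm.antidiagonal 3).over K) γ w = w) ↔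
      Valued.v (ϖ⁻¹ * B₀ σ 3 (fun i => ((κ : GL (Fin 3) K) : Matrix (Fin 3) (Fin 3) K) i 0)
        (((((u⁻¹ * γ * u : unitaryGroupOfForm σ ((StdForm.antidiagonal 3).over K)) : GL (Fin 3) K) : Matrix (Fin 3) (Fin 3) K) - 1).mulVec
          (fun i => ((κ : GL (Fin 3) K) : Matrix (Fin 3) (Fin 3) K) i 0))) < 1 := by
  classical
  have hcount := ncard_fixed_children_latticeGraphIso_of_congr hvσ hσϖ hϖ hres hγK hκK hγϖ
  -- the punctured star is nonempty: it has `q ≥ 1` elements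
  have hstar : ((latticeGraph σ ϖ ((StdForm.antidiagonal 3).over K)).neighborSet
      (latticeGraphIso σ ϖ ((StdForm.antidiagonal 3).over K) (u * κ) ⟨latt (Matrix.diagonal ![(1 : K), 1, ϖ]), 2, isVertexLattice_two_N₁_of_neg hσϖ hϖ⟩)).ncard =
      Nat.card 𝓀[K] + 1 := by
    rw [ncard_neighborSet_latticeGraphIso]; exact ncard_neighborSet_N₁_of_neg hvσ hσϖ hϖ hres
  have hq : 0 < Nat.card 𝓀[K] := Nat.card_pos
  constructor
  · intro hall
    -- pick a neighbour `w ≠ v` of `c` (there are `q ≥ 1` of them); it is fixed, so the test holds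
    have hvmem : latticeGraphIso σ ϖ ((StdForm.antidiagonal 3).over K) u ⟨stdLattice K 3, 0, isSelfDualLattice_stdLattice_three_of_v hϖ⟩ ∈
        (latticeGraph σ ϖ ((StdForm.antidiagonal 3).over K)).neighborSet
          (latticeGraphIso σ ϖ ((StdForm.antidiagonal 3).over K) (u * κ) ⟨latt (Matrix.diagonal ![(1 : K), 1, ϖ]), 2, isVertexLattice_two_N₁_of_neg hσϖ hϖ⟩) := by
      have hL : latticeGraphIso σ ϖ ((StdForm.antidiagonal 3).over K) κ ⟨stdLattice K 3, 0, isSelfDualLattice_stdLattice_three_of_v hϖ⟩ =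
          ⟨stdLattice K 3, 0, isSelfDualLattice_stdLattice_three_of_v hϖ⟩ :=
        Subtype.ext (by rw [latticeGraphIso_apply_val]; exact mapGL_stdLattice_of_mem_unitaryInt hκK)
      rw [SimpleGraph.mem_neighborSet, latticeGraphIso_mul_apply, ← hL]
      exact (latticeGraphIso σ ϖ ((StdForm.antidiagonal 3).over K) u).map_adj_iff.2
        ((latticeGraphIso σ ϖ ((StdForm.antidiagonal 3).over K) κ).map_adj_iff.2 (stdLattice_mem_neighborSet_N₁_of_neg hvσ hσϖ hϖ))
    have hpunct : (((latticeGraph σ ϖ ((StdForm.antidiagonal 3).over K)).neighborSet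
        (latticeGraphIso σ ϖ ((StdForm.antidiagonal 3).over K) (u * κ) ⟨latt (Matrix.diagonal ![(1 : K), 1, ϖ]), 2, isVertexLattice_two_N₁_of_neg hσϖ hϖ⟩)) \
          {latticeGraphIso σ ϖ ((StdForm.antidiagonal 3).over K) u ⟨stdLattice K 3, 0, isSelfDualLattice_stdLattice_three_of_v hϖ⟩}).ncard = Nat.card 𝓀[K] := by
      rw [Set.ncard_sdiff_singleton_of_mem hvmem, hstar, Nat.add_sub_cancel]
    obtain ⟨w, hw, hwv⟩ := Set.nonempty_of_ncard_ne_zero (by rw [hpunct]; exact hq.ne')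
    rw [Set.mem_singleton_iff] at hwv
    refine v_B₀_lt_one_of_exists_fixed_child_latticeGraphIso_of_congr hvσ hσϖ hϖ hres hγK hκK hγϖ ⟨w, hw, fun heq => hwv ?_, ?_⟩
    · exact Subtype.ext (by rw [latticeGraphIso_apply_val]; exact heq)
    · exact (latticeGraphIso_eq_iff_mapGL_eq γ w).1 (hall w hw)
  · intro htest w hw
    rw [if_pos htest] at hcount
    obtain ⟨w₀, hw₀, hne₀, hfix₀⟩ := Set.nonempty_of_ncard_ne_zero (by rw [hcount]; exact hq.ne')
    exact (latticeGraphIso_eq_iff_mapGL_eq γ w).2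
      (forall_mapGL_eq_self_of_exists_fixed_child_latticeGraphIso_of_congr hvσ hσϖ hϖ hres hγK hκK hγϖ ⟨w₀, hw₀, hne₀, hfix₀⟩ hw)

/-- **THE FIXED COUNT THROUGH A CHILD, «passes» form**: `#{w ∈ star((uκ)·N₁) : w ≠ u·L₀, γ·w = w} = if (every neighbour of (uκ)·N₁ is fixed) then q else 0`.
[cite: Tits1979, §2.4, §3.5] [cite: Kottwitz1986, §3] -/
theorem ncard_fixed_children_latticeGraphIso_eq_ite_forall (hvσ : ∀ a, Valued.v (σ a) = Valued.v a) (hσϖ : σ ϖ = -ϖ) (hϖ : Valued.v ϖ = WithZero.exp (-1 : ℤ))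
    (hres : ∀ x : K, Valued.v x ≤ 1 → Valued.v (σ x - x) < 1) [Finite 𝓀[K]]
    {γ u κ : unitaryGroupOfForm σ ((StdForm.antidiagonal 3).over K)}
    (hγK : u⁻¹ * γ * u ∈ unitaryInt σ ((StdForm.antidiagonal 3).over K)) (hκK : κ ∈ unitaryInt σ ((StdForm.antidiagonal 3).over K))
    (hγϖ : ∀ i j, Valued.v (((((u⁻¹ * γ * u : unitaryGroupOfForm σ ((StdForm.antidiagonal 3).over K)) : GL (Fin 3) K) : Matrix (Fin 3) (Fin 3) K) - 1) i j) ≤ Valued.v ϖ)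
    [Decidable (∀ w ∈ (latticeGraph σ ϖ ((StdForm.antidiagonal 3).over K)).neighborSet
          (latticeGraphIso σ ϖ ((StdForm.antidiagonal 3).over K) (u * κ) ⟨latt (Matrix.diagonal ![(1 : K), 1, ϖ]), 2, isVertexLattice_two_N₁_of_neg hσϖ hϖ⟩),
        latticeGraphIso σ ϖ ((StdForm.antidiagonal 3).over K) γ w = w)] :
    {w | w ∈ (latticeGraph σ ϖ ((StdForm.antidiagonal 3).over K)).neighborSet
          (latticeGraphIso σ ϖ ((StdForm.antidiagonal 3).over K) (u * κ) ⟨latt (Matrix.diagonal ![(1 : K), 1, ϖ]), 2, isVertexLattice_two_N₁_of_neg hσϖ hϖ⟩) ∧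
        w.1 ≠ mapGL (u : GL (Fin 3) K) (stdLattice K 3) ∧ mapGL (γ : GL (Fin 3) K) w.1 = w.1}.ncard =
      if (∀ w ∈ (latticeGraph σ ϖ ((StdForm.antidiagonal 3).over K)).neighborSet
          (latticeGraphIso σ ϖ ((StdForm.antidiagonal 3).over K) (u * κ) ⟨latt (Matrix.diagonal ![(1 : K), 1, ϖ]), 2, isVertexLattice_two_N₁_of_neg hσϖ hϖ⟩),
        latticeGraphIso σ ϖ ((StdForm.antidiagonal 3).over K) γ w = w) then Nat.card 𝓀[K] else 0 := by
  rw [ncard_fixed_children_latticeGraphIso_of_congr hvσ hσϖ hϖ hres hγK hκK hγϖ]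
  by_cases h : ∀ w ∈ (latticeGraph σ ϖ ((StdForm.antidiagonal 3).over K)).neighborSet
          (latticeGraphIso σ ϖ ((StdForm.antidiagonal 3).over K) (u * κ) ⟨latt (Matrix.diagonal ![(1 : K), 1, ϖ]), 2, isVertexLattice_two_N₁_of_neg hσϖ hϖ⟩),
        latticeGraphIso σ ϖ ((StdForm.antidiagonal 3).over K) γ w = w
  · rw [if_pos h, if_pos ((forall_fixed_neighbor_iff_v_B₀_lt_one_of_congr hvσ hσϖ hϖ hres hγK hκK hγϖ).1 h)]
  · rw [if_neg h, if_neg (fun ht => h ((forall_fixed_neighbor_iff_v_B₀_lt_one_of_congr hvσ hσϖ hϖ hres hγK hκK hγϖ).2 ht))]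

/-! ## §3 The fixed grandchildren of a fixed self-dual vertex in the rooted tree -/

/-- **`#GC(v) = q · #{children of v passing}`** — the multiplicity law of the tree induction at a fixed self-dual vertex `v ≠ r = L₀` one level deep
(`(γ − 1)·v ⊆ ϖ·v`): the fixed vertices two steps further from the root, `GC(v) = {w | ∃ c, (v ~ c, dist(r,c) = dist(r,v)+1, γ·c = c) ∧ (c ~ w, dist(r,w) = dist(r,c)+1,
γ·w = w)}` (F0P3a-p01's `hGC` binder), come in slices of `q` through the children `c` all of whose neighbours are fixed, and in no other slice (§2; the slices are
disjoint because `G` is a tree, and every child is fixed, ★ G3 §3).  `hT`: ★ `isTree_latticeGraph_three_of_neg`. [cite: Kottwitz1986, §3] [cite: Serre1980Trees, I.2.3, II.1.1]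
[cite: Tits1979, §2.4, §3.5] [cite: BruhatTits1972, §10] -/
theorem ncard_fixedGrandchildren_eq_mul_ncard_passingChildren (hσ : ∀ x, σ (σ x) = x) (hvσ : ∀ a, Valued.v (σ a) = Valued.v a) (hσϖ : σ ϖ = -ϖ)
    (hϖ : Valued.v ϖ = WithZero.exp (-1 : ℤ)) (hres : ∀ x : K, Valued.v x ≤ 1 → Valued.v (σ x - x) < 1) (h2 : Valued.v (2 : K) = 1) [Finite 𝓀[K]]
    (hT : (latticeGraph σ ϖ ((StdForm.antidiagonal 3).over K)).IsTree)
    {γ : unitaryGroupOfForm σ ((StdForm.antidiagonal 3).over K)}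
    {v : {M : Submodule 𝒪[K] (Fin 3 → K) // IsVertex σ ϖ ((StdForm.antidiagonal 3).over K) M}}
    (hv : IsSelfDualLattice σ ϖ ((StdForm.antidiagonal 3).over K) v.1) (hvr : v ≠ ⟨stdLattice K 3, 0, isSelfDualLattice_stdLattice_three_of_v hϖ⟩)
    (hfix : latticeGraphIso σ ϖ ((StdForm.antidiagonal 3).over K) γ v = v)
    (hlev : v.1.map ((Matrix.toLin' (((γ : GL (Fin 3) K) : Matrix (Fin 3) (Fin 3) K) - 1)).restrictScalars 𝒪[K]) ≤ scaleLattice ϖ v.1) :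
    {w | ∃ c, ((latticeGraph σ ϖ ((StdForm.antidiagonal 3).over K)).Adj v c ∧
          (latticeGraph σ ϖ ((StdForm.antidiagonal 3).over K)).dist ⟨stdLattice K 3, 0, isSelfDualLattice_stdLattice_three_of_v hϖ⟩ c =
            (latticeGraph σ ϖ ((StdForm.antidiagonal 3).over K)).dist ⟨stdLattice K 3, 0, isSelfDualLattice_stdLattice_three_of_v hϖ⟩ v + 1 ∧
          latticeGraphIso σ ϖ ((StdForm.antidiagonal 3).over K) γ c = c) ∧
        ((latticeGraph σ ϖ ((StdForm.antidiagonal 3).over K)).Adj c w ∧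
          (latticeGraph σ ϖ ((StdForm.antidiagonal 3).over K)).dist ⟨stdLattice K 3, 0, isSelfDualLattice_stdLattice_three_of_v hϖ⟩ w =
            (latticeGraph σ ϖ ((StdForm.antidiagonal 3).over K)).dist ⟨stdLattice K 3, 0, isSelfDualLattice_stdLattice_three_of_v hϖ⟩ c + 1 ∧
          latticeGraphIso σ ϖ ((StdForm.antidiagonal 3).over K) γ w = w)}.ncard =
      Nat.card 𝓀[K] *
        {c | (latticeGraph σ ϖ ((StdForm.antidiagonal 3).over K)).Adj v c ∧
          (latticeGraph σ ϖ ((StdForm.antidiagonal 3).over K)).dist ⟨stdLattice K 3, 0, isSelfDualLattice_stdLattice_three_of_v hϖ⟩ c =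
            (latticeGraph σ ϖ ((StdForm.antidiagonal 3).over K)).dist ⟨stdLattice K 3, 0, isSelfDualLattice_stdLattice_three_of_v hϖ⟩ v + 1 ∧
          ∀ w ∈ (latticeGraph σ ϖ ((StdForm.antidiagonal 3).over K)).neighborSet c, latticeGraphIso σ ϖ ((StdForm.antidiagonal 3).over K) γ w = w}.ncard := by
  classical
  -- notation-free abbreviations
  set G := latticeGraph σ ϖ ((StdForm.antidiagonal 3).over K) with hG
  set r : {M : Submodule 𝒪[K] (Fin 3 → K) // IsVertex σ ϖ ((StdForm.antidiagonal 3).over K) M} :=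
    ⟨stdLattice K 3, 0, isSelfDualLattice_stdLattice_three_of_v hϖ⟩ with hr
  have hϖ0 : ϖ ≠ 0 := uniformizer_ne_zero hϖ
  -- the rooted parent map
  obtain ⟨p, hpar, hchild, -, -⟩ := exists_rooted_parent hT r
  -- `v = u·L₀`, `γ′ = u⁻¹γu ∈ K₀`, `γ′ ≡ 1 (mod ϖ)`
  obtain ⟨u, hu⟩ := exists_latticeGraphIso_root_eq_of_v_two hσ hvσ hϖ h2 v hv (isSelfDualLattice_stdLattice_three_of_v hϖ)
  subst hu
  have hγK : u⁻¹ * γ * u ∈ unitaryInt σ ((StdForm.antidiagonal 3).over K) := mem_unitaryInt_conj_of_latticeGraphIso_apply_root_eq hfix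
  have hγϖ : ∀ i j, Valued.v (((((u⁻¹ * γ * u : unitaryGroupOfForm σ ((StdForm.antidiagonal 3).over K)) : GL (Fin 3) K) : Matrix (Fin 3) (Fin 3) K) - 1) i j) ≤ Valued.v ϖ :=
    (forall_v_conj_sub_one_le_iff_map_sub_one_le_scaleLattice γ u hϖ0).1 hlev
  have hγ1 : ∀ i j, Valued.v (((((u⁻¹ * γ * u : unitaryGroupOfForm σ ((StdForm.antidiagonal 3).over K)) : GL (Fin 3) K) : Matrix (Fin 3) (Fin 3) K) - 1) i j) < 1 :=
    fun i j => lt_of_le_of_lt (hγϖ i j) (by rw [hϖ, ← WithZero.exp_zero]; exact WithZero.exp_lt_exp.2 (by norm_num))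
  -- every neighbour of `v` is fixed
  have hnbfix : ∀ c ∈ G.neighborSet (latticeGraphIso σ ϖ ((StdForm.antidiagonal 3).over K) u r), latticeGraphIso σ ϖ ((StdForm.antidiagonal 3).over K) γ c = c :=
    fun c hc => (latticeGraphIso_eq_iff_mapGL_eq γ c).2 (mapGL_eq_self_of_mem_neighborSet_latticeGraphIso_root_of_congr hσ hvσ hσϖ hϖ h2 hγK hγ1 hc)
  -- children: neighbours other than the parent
  have hvr' : latticeGraphIso σ ϖ ((StdForm.antidiagonal 3).over K) u r ≠ r := hvr
  have hchildren : ∀ c, (G.Adj (latticeGraphIso σ ϖ ((StdForm.antidiagonal 3).over K) u r) c ∧ G.dist r c = G.dist r (latticeGraphIso σ ϖ ((StdForm.antidiagonal 3).over K) u r) + 1) →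
      c ≠ r ∧ p c = latticeGraphIso σ ϖ ((StdForm.antidiagonal 3).over K) u r := by
    rintro c ⟨hadj, hdc⟩
    have hcp : c ≠ p (latticeGraphIso σ ϖ ((StdForm.antidiagonal 3).over K) u r) := by
      intro hcp
      have h := (hpar _ hvr').2
      rw [← hcp] at h
      omega
    refine ⟨fun hcr => ?_, (hchild _ c hvr' hadj hcp).2⟩
    rw [hcr, SimpleGraph.dist_self] at hdc
    omega
  -- the slice through a child `c`
  have hslice : ∀ c, (G.Adj (latticeGraphIso σ ϖ ((StdForm.antidiagonal 3).over K) u r) c ∧ G.dist r c = G.dist r (latticeGraphIso σ ϖ ((StdForm.antidiagonal 3).over K) u r) + 1) →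
      {w | G.Adj c w ∧ G.dist r w = G.dist r c + 1 ∧ latticeGraphIso σ ϖ ((StdForm.antidiagonal 3).over K) γ w = w} =
        {w | w ∈ G.neighborSet c ∧ w.1 ≠ mapGL (u : GL (Fin 3) K) (stdLattice K 3) ∧ mapGL (γ : GL (Fin 3) K) w.1 = w.1} := by
    rintro c ⟨hadj, hdc⟩
    obtain ⟨hcr, hpc⟩ := hchildren c ⟨hadj, hdc⟩
    ext w
    simp only [Set.mem_setOf_eq, SimpleGraph.mem_neighborSet]
    constructor
    · rintro ⟨hcw, hdw, hfw⟩
      refine ⟨hcw, fun heq => ?_, (latticeGraphIso_eq_iff_mapGL_eq γ w).1 hfw⟩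
      have hwv : w = latticeGraphIso σ ϖ ((StdForm.antidiagonal 3).over K) u r := Subtype.ext (by rw [latticeGraphIso_apply_val]; exact heq)
      rw [hwv] at hdw
      omega
    · rintro ⟨hcw, hne, hfw⟩
      have hwp : w ≠ p c := by
        rw [hpc]; intro hwv; apply hne; rw [hwv, latticeGraphIso_apply_val]
      exact ⟨hcw, (hchild c w hcr hcw hwp).1, (latticeGraphIso_eq_iff_mapGL_eq γ w).2 hfw⟩
  -- the slice count: `q` if `c` passes, `0` otherwise
  have hslicecount : ∀ c, (G.Adj (latticeGraphIso σ ϖ ((StdForm.antidiagonal 3).over K) u r) c ∧ G.dist r c = G.dist r (latticeGraphIso σ ϖ ((StdForm.antidiagonal 3).over K) u r) + 1) →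
      {w | G.Adj c w ∧ G.dist r w = G.dist r c + 1 ∧ latticeGraphIso σ ϖ ((StdForm.antidiagonal 3).over K) γ w = w}.ncard =
        if (∀ w ∈ G.neighborSet c, latticeGraphIso σ ϖ ((StdForm.antidiagonal 3).over K) γ w = w) then Nat.card 𝓀[K] else 0 := by
    rintro c ⟨hadj, hdc⟩
    rw [hslice c ⟨hadj, hdc⟩]
    obtain ⟨κ, hκK, rfl⟩ := (mem_neighborSet_latticeGraphIso_root_iff hσ hvσ hσϖ hϖ h2 u c).1 hadj
    rw [ncard_fixed_children_latticeGraphIso_eq_ite_forall hvσ hσϖ hϖ hres hγK hκK hγϖ]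
  -- finiteness of the star of `v`
  have hstarv : (G.neighborSet (latticeGraphIso σ ϖ ((StdForm.antidiagonal 3).over K) u r)).ncard = Nat.card 𝓀[K] + 1 := by
    rw [ncard_neighborSet_latticeGraphIso]
    exact ncard_neighborSet_root_of_ramified hσ hvσ hϖ hres h2 (isVertexLattice_two_N₁_of_neg hσϖ hϖ)
  have hfinv : (G.neighborSet (latticeGraphIso σ ϖ ((StdForm.antidiagonal 3).over K) u r)).Finite :=
    Set.finite_of_ncard_ne_zero (by rw [hstarv]; exact Nat.succ_ne_zero _)
  -- the children as a finset
  set CH := {c | G.Adj (latticeGraphIso σ ϖ ((StdForm.antidiagonal 3).over K) u r) c ∧ G.dist r c = G.dist r (latticeGraphIso σ ϖ ((StdForm.antidiagonal 3).over K) u r) + 1} with hCH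
  have hCHfin : CH.Finite := hfinv.subset (fun c hc => hc.1)
  set I := hCHfin.toFinset with hI
  have hmemI : ∀ c, c ∈ I ↔ G.Adj (latticeGraphIso σ ϖ ((StdForm.antidiagonal 3).over K) u r) c ∧ G.dist r c = G.dist r (latticeGraphIso σ ϖ ((StdForm.antidiagonal 3).over K) u r) + 1 :=
    fun c => by rw [hI, Set.Finite.mem_toFinset]; rfl
  -- GC as a disjoint union of slices over the children
  have hunion : {w | ∃ c, (G.Adj (latticeGraphIso σ ϖ ((StdForm.antidiagonal 3).over K) u r) c ∧ G.dist r c = G.dist r (latticeGraphIso σ ϖ ((StdForm.antidiagonal 3).over K) u r) + 1 ∧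
          latticeGraphIso σ ϖ ((StdForm.antidiagonal 3).over K) γ c = c) ∧
        (G.Adj c w ∧ G.dist r w = G.dist r c + 1 ∧ latticeGraphIso σ ϖ ((StdForm.antidiagonal 3).over K) γ w = w)} =
      ⋃ c ∈ I, {w | G.Adj c w ∧ G.dist r w = G.dist r c + 1 ∧ latticeGraphIso σ ϖ ((StdForm.antidiagonal 3).over K) γ w = w} := by
    ext w
    simp only [Set.mem_setOf_eq, Set.mem_iUnion, exists_prop]
    constructor
    · rintro ⟨c, ⟨hadj, hdc, -⟩, hw⟩
      exact ⟨c, (hmemI c).2 ⟨hadj, hdc⟩, hw⟩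
    · rintro ⟨c, hc, hw⟩
      obtain ⟨hadj, hdc⟩ := (hmemI c).1 hc
      exact ⟨c, ⟨hadj, hdc, hnbfix c hadj⟩, hw⟩
  have hdisj : ∀ c ∈ I, ∀ c' ∈ I, c ≠ c' →
      Disjoint {w | G.Adj c w ∧ G.dist r w = G.dist r c + 1 ∧ latticeGraphIso σ ϖ ((StdForm.antidiagonal 3).over K) γ w = w}
        {w | G.Adj c' w ∧ G.dist r w = G.dist r c' + 1 ∧ latticeGraphIso σ ϖ ((StdForm.antidiagonal 3).over K) γ w = w} := by
    intro c hc c' hc' hne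
    rw [Set.disjoint_left]
    rintro w ⟨hcw, hdw, -⟩ ⟨hc'w, hd'w, -⟩
    obtain ⟨hcr, -⟩ := hchildren c ((hmemI c).1 hc)
    obtain ⟨hc'r, -⟩ := hchildren c' ((hmemI c').1 hc')
    have hwpc : w ≠ p c := by
      intro hwp
      have h := (hpar c hcr).2
      rw [← hwp] at h
      omega
    have hwpc' : w ≠ p c' := by
      intro hwp
      have h := (hpar c' hc'r).2
      rw [← hwp] at h
      omega
    exact hne (((hchild c w hcr hcw hwpc).2).symm.trans (hchild c' w hc'r hc'w hwpc').2)
  have hslicefin : ∀ c ∈ I, {w | G.Adj c w ∧ G.dist r w = G.dist r c + 1 ∧ latticeGraphIso σ ϖ ((StdForm.antidiagonal 3).over K) γ w = w}.Finite := by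
    intro c hc
    obtain ⟨hadj, hdc⟩ := (hmemI c).1 hc
    rw [hslice c ⟨hadj, hdc⟩]
    obtain ⟨κ, hκK, rfl⟩ := (mem_neighborSet_latticeGraphIso_root_iff hσ hvσ hσϖ hϖ h2 u c).1 hadj
    have hstarc : (G.neighborSet (latticeGraphIso σ ϖ ((StdForm.antidiagonal 3).over K) (u * κ) ⟨latt (Matrix.diagonal ![(1 : K), 1, ϖ]), 2, isVertexLattice_two_N₁_of_neg hσϖ hϖ⟩)).Finite :=
      Set.finite_of_ncard_ne_zero (by rw [ncard_neighborSet_latticeGraphIso, ncard_neighborSet_N₁_of_neg hvσ hσϖ hϖ hres]; exact Nat.succ_ne_zero _)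
    exact hstarc.subset (fun w hw => hw.1)
  -- sum the slices
  rw [hunion, ncard_biUnion_finset_eq_sum_of_disjoint_G3 I _ hslicefin hdisj]
  rw [Finset.sum_congr rfl (fun c hc => hslicecount c ((hmemI c).1 hc))]
  rw [Finset.sum_ite, Finset.sum_const_zero, add_zero, Finset.sum_const, smul_eq_mul, mul_comm]
  congr 1
  rw [← Set.ncard_coe_finset]
  congr 1
  ext c
  simp only [Finset.coe_filter, Set.mem_setOf_eq, hmemI]
  exact ⟨fun ⟨⟨h1, h2'⟩, h3⟩ => ⟨h1, h2', h3⟩, fun ⟨h1, h2', h3⟩ => ⟨⟨h1, h2'⟩, h3⟩⟩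

/-- **Two levels deep every child passes**: for `v = u·L₀` with `γ′ = u⁻¹γu ≡ 1 (mod ϖ²)` and a modular neighbour `(uκ)·N₁`, every vertex adjacent to `(uκ)·N₁` is fixed
(★ G3 `ncard_fixed_children_latticeGraphIso_of_congr_sq`: the slice has `q ≥ 1` fixed children). [cite: Tits1979, §3.5] [cite: Kottwitz1986, §3] -/
theorem forall_fixed_neighbor_of_congr_sq (hvσ : ∀ a, Valued.v (σ a) = Valued.v a) (hσϖ : σ ϖ = -ϖ) (hϖ : Valued.v ϖ = WithZero.exp (-1 : ℤ))
    (hres : ∀ x : K, Valued.v x ≤ 1 → Valued.v (σ x - x) < 1) [Finite 𝓀[K]]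
    {γ u κ : unitaryGroupOfForm σ ((StdForm.antidiagonal 3).over K)}
    (hγK : u⁻¹ * γ * u ∈ unitaryInt σ ((StdForm.antidiagonal 3).over K)) (hκK : κ ∈ unitaryInt σ ((StdForm.antidiagonal 3).over K))
    (hγϖ2 : ∀ i j, Valued.v (((((u⁻¹ * γ * u : unitaryGroupOfForm σ ((StdForm.antidiagonal 3).over K)) : GL (Fin 3) K) : Matrix (Fin 3) (Fin 3) K) - 1) i j) ≤ Valued.v ϖ ^ 2)
    {w : {M : Submodule 𝒪[K] (Fin 3 → K) // IsVertex σ ϖ ((StdForm.antidiagonal 3).over K) M}}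
    (hw : w ∈ (latticeGraph σ ϖ ((StdForm.antidiagonal 3).over K)).neighborSet
          (latticeGraphIso σ ϖ ((StdForm.antidiagonal 3).over K) (u * κ) ⟨latt (Matrix.diagonal ![(1 : K), 1, ϖ]), 2, isVertexLattice_two_N₁_of_neg hσϖ hϖ⟩)) :
    latticeGraphIso σ ϖ ((StdForm.antidiagonal 3).over K) γ w = w := by
  have hq : 0 < Nat.card 𝓀[K] := Nat.card_pos
  have hϖ1 : Valued.v ϖ < 1 := by rw [hϖ, ← WithZero.exp_zero]; exact WithZero.exp_lt_exp.2 (by norm_num)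
  have hγϖ : ∀ i j, Valued.v (((((u⁻¹ * γ * u : unitaryGroupOfForm σ ((StdForm.antidiagonal 3).over K)) : GL (Fin 3) K) : Matrix (Fin 3) (Fin 3) K) - 1) i j) ≤ Valued.v ϖ :=
    fun i j => (hγϖ2 i j).trans (by rw [sq]; exact mul_le_of_le_one_left zero_le hϖ1.le)
  have hcount := ncard_fixed_children_latticeGraphIso_of_congr_sq hvσ hσϖ hϖ hres hγK hκK hγϖ2
  obtain ⟨w₀, hw₀, hne₀, hfix₀⟩ := Set.nonempty_of_ncard_ne_zero (by rw [hcount]; exact hq.ne')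
  exact (latticeGraphIso_eq_iff_mapGL_eq γ w).2
    (forall_mapGL_eq_self_of_exists_fixed_child_latticeGraphIso_of_congr hvσ hσϖ hϖ hres hγK hκK hγϖ ⟨w₀, hw₀, hne₀, hfix₀⟩ hw)

/-- **THE CHILDREN OF A SELF-DUAL VERTEX `v ≠ r` NUMBER `q`**: in the rooted tree the neighbours of `v` one step further from the root are all its `q + 1` modular
neighbours but the parent. [cite: Serre1980Trees, I.2.3, II.1.1] [cite: Tits1979, §2.4] -/
theorem ncard_children_eq_of_isSelfDualLattice (hσ : ∀ x, σ (σ x) = x) (hvσ : ∀ a, Valued.v (σ a) = Valued.v a) (hσϖ : σ ϖ = -ϖ)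
    (hϖ : Valued.v ϖ = WithZero.exp (-1 : ℤ)) (hres : ∀ x : K, Valued.v x ≤ 1 → Valued.v (σ x - x) < 1) (h2 : Valued.v (2 : K) = 1) [Finite 𝓀[K]]
    (hT : (latticeGraph σ ϖ ((StdForm.antidiagonal 3).over K)).IsTree)
    {v : {M : Submodule 𝒪[K] (Fin 3 → K) // IsVertex σ ϖ ((StdForm.antidiagonal 3).over K) M}}
    (hv : IsSelfDualLattice σ ϖ ((StdForm.antidiagonal 3).over K) v.1) (hvr : v ≠ ⟨stdLattice K 3, 0, isSelfDualLattice_stdLattice_three_of_v hϖ⟩) :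
    {c | (latticeGraph σ ϖ ((StdForm.antidiagonal 3).over K)).Adj v c ∧
        (latticeGraph σ ϖ ((StdForm.antidiagonal 3).over K)).dist ⟨stdLattice K 3, 0, isSelfDualLattice_stdLattice_three_of_v hϖ⟩ c =
          (latticeGraph σ ϖ ((StdForm.antidiagonal 3).over K)).dist ⟨stdLattice K 3, 0, isSelfDualLattice_stdLattice_three_of_v hϖ⟩ v + 1}.ncard = Nat.card 𝓀[K] := by
  classical
  set G := latticeGraph σ ϖ ((StdForm.antidiagonal 3).over K) with hG
  set r : {M : Submodule 𝒪[K] (Fin 3 → K) // IsVertex σ ϖ ((StdForm.antidiagonal 3).over K) M} :=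
    ⟨stdLattice K 3, 0, isSelfDualLattice_stdLattice_three_of_v hϖ⟩ with hr
  obtain ⟨p, hpar, hchild, -, -⟩ := exists_rooted_parent hT r
  have hstar : (G.neighborSet v).ncard = Nat.card 𝓀[K] + 1 :=
    ncard_neighborSet_of_isSelfDualLattice_of_ramified hσ hvσ hϖ hres h2 (isVertexLattice_two_N₁_of_neg hσϖ hϖ) v hv
  have hfin : (G.neighborSet v).Finite := Set.finite_of_ncard_ne_zero (by rw [hstar]; exact Nat.succ_ne_zero _)
  have hpv := hpar v hvr
  have hset : {c | G.Adj v c ∧ G.dist r c = G.dist r v + 1} = G.neighborSet v \ {p v} := by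
    ext c
    simp only [Set.mem_setOf_eq, Set.mem_sdiff, SimpleGraph.mem_neighborSet, Set.mem_singleton_iff]
    constructor
    · rintro ⟨hadj, hdc⟩
      refine ⟨hadj, fun hcp => ?_⟩
      have h := hpv.2
      rw [← hcp] at h
      omega
    · rintro ⟨hadj, hcp⟩
      exact ⟨hadj, (hchild v c hvr hadj hcp).1⟩
  have hpmem : p v ∈ G.neighborSet v := hpv.1
  rw [hset, Set.ncard_sdiff_singleton_of_mem hpmem, hstar, Nat.add_sub_cancel]

/-- **TWO LEVELS DEEP: `#GC(v) = q²`** — at a fixed self-dual vertex `v ≠ r` with `(γ − 1)·v ⊆ ϖ²·v` all `q` children pass, so all `q²` grandchildren are fixed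
(the multiplicity `q ^ 2` of the engine's binders `hE`, `hP` and the total of `hO`). [cite: Kottwitz1986, §3] [cite: Tits1979, §3.5] [cite: Serre1980Trees, II.1.1] -/
theorem ncard_fixedGrandchildren_eq_sq_of_level_two (hσ : ∀ x, σ (σ x) = x) (hvσ : ∀ a, Valued.v (σ a) = Valued.v a) (hσϖ : σ ϖ = -ϖ)
    (hϖ : Valued.v ϖ = WithZero.exp (-1 : ℤ)) (hres : ∀ x : K, Valued.v x ≤ 1 → Valued.v (σ x - x) < 1) (h2 : Valued.v (2 : K) = 1) [Finite 𝓀[K]]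
    (hT : (latticeGraph σ ϖ ((StdForm.antidiagonal 3).over K)).IsTree)
    {γ : unitaryGroupOfForm σ ((StdForm.antidiagonal 3).over K)}
    {v : {M : Submodule 𝒪[K] (Fin 3 → K) // IsVertex σ ϖ ((StdForm.antidiagonal 3).over K) M}}
    (hv : IsSelfDualLattice σ ϖ ((StdForm.antidiagonal 3).over K) v.1) (hvr : v ≠ ⟨stdLattice K 3, 0, isSelfDualLattice_stdLattice_three_of_v hϖ⟩)
    (hfix : latticeGraphIso σ ϖ ((StdForm.antidiagonal 3).over K) γ v = v)
    (hlev2 : v.1.map ((Matrix.toLin' (((γ : GL (Fin 3) K) : Matrix (Fin 3) (Fin 3) K) - 1)).restrictScalars 𝒪[K]) ≤ scaleLattice (ϖ ^ 2) v.1) :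
    {w | ∃ c, ((latticeGraph σ ϖ ((StdForm.antidiagonal 3).over K)).Adj v c ∧
          (latticeGraph σ ϖ ((StdForm.antidiagonal 3).over K)).dist ⟨stdLattice K 3, 0, isSelfDualLattice_stdLattice_three_of_v hϖ⟩ c =
            (latticeGraph σ ϖ ((StdForm.antidiagonal 3).over K)).dist ⟨stdLattice K 3, 0, isSelfDualLattice_stdLattice_three_of_v hϖ⟩ v + 1 ∧
          latticeGraphIso σ ϖ ((StdForm.antidiagonal 3).over K) γ c = c) ∧
        ((latticeGraph σ ϖ ((StdForm.antidiagonal 3).over K)).Adj c w ∧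
          (latticeGraph σ ϖ ((StdForm.antidiagonal 3).over K)).dist ⟨stdLattice K 3, 0, isSelfDualLattice_stdLattice_three_of_v hϖ⟩ w =
            (latticeGraph σ ϖ ((StdForm.antidiagonal 3).over K)).dist ⟨stdLattice K 3, 0, isSelfDualLattice_stdLattice_three_of_v hϖ⟩ c + 1 ∧
          latticeGraphIso σ ϖ ((StdForm.antidiagonal 3).over K) γ w = w)}.ncard = Nat.card 𝓀[K] ^ 2 := by
  classical
  have hϖ0 : ϖ ≠ 0 := uniformizer_ne_zero hϖ
  have hϖ1 : Valued.v ϖ < 1 := by rw [hϖ, ← WithZero.exp_zero]; exact WithZero.exp_lt_exp.2 (by norm_num)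
  -- `v = u·L₀`, `γ′ ≡ 1 (mod ϖ²)` entrywise, hence `(mod ϖ)` and the LEVEL token `ϖ`
  obtain ⟨u, hu⟩ := exists_latticeGraphIso_root_eq_of_v_two hσ hvσ hϖ h2 v hv (isSelfDualLattice_stdLattice_three_of_v hϖ)
  subst hu
  have hγK : u⁻¹ * γ * u ∈ unitaryInt σ ((StdForm.antidiagonal 3).over K) := mem_unitaryInt_conj_of_latticeGraphIso_apply_root_eq hfix
  have hγϖ2 : ∀ i j, Valued.v (((((u⁻¹ * γ * u : unitaryGroupOfForm σ ((StdForm.antidiagonal 3).over K)) : GL (Fin 3) K) : Matrix (Fin 3) (Fin 3) K) - 1) i j) ≤ Valued.v ϖ ^ 2 := by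
    have h := (forall_v_conj_sub_one_le_iff_map_sub_one_le_scaleLattice γ u (pow_ne_zero 2 hϖ0)).1 hlev2
    intro i j; rw [← map_pow]; exact h i j
  have hγϖ : ∀ i j, Valued.v (((((u⁻¹ * γ * u : unitaryGroupOfForm σ ((StdForm.antidiagonal 3).over K)) : GL (Fin 3) K) : Matrix (Fin 3) (Fin 3) K) - 1) i j) ≤ Valued.v ϖ :=
    fun i j => (hγϖ2 i j).trans (by rw [sq]; exact mul_le_of_le_one_left zero_le hϖ1.le)
  have hlev := (forall_v_conj_sub_one_le_iff_map_sub_one_le_scaleLattice γ u hϖ0).2 hγϖ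
  rw [ncard_fixedGrandchildren_eq_mul_ncard_passingChildren hσ hvσ hσϖ hϖ hres h2 hT hv hvr hfix hlev, sq]
  congr 1
  -- every child passes
  have hset : {c | (latticeGraph σ ϖ ((StdForm.antidiagonal 3).over K)).Adj (latticeGraphIso σ ϖ ((StdForm.antidiagonal 3).over K) u ⟨stdLattice K 3, 0, isSelfDualLattice_stdLattice_three_of_v hϖ⟩) c ∧
        (latticeGraph σ ϖ ((StdForm.antidiagonal 3).over K)).dist ⟨stdLattice K 3, 0, isSelfDualLattice_stdLattice_three_of_v hϖ⟩ c =
          (latticeGraph σ ϖ ((StdForm.antidiagonal 3).over K)).dist ⟨stdLattice K 3, 0, isSelfDualLattice_stdLattice_three_of_v hϖ⟩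
            (latticeGraphIso σ ϖ ((StdForm.antidiagonal 3).over K) u ⟨stdLattice K 3, 0, isSelfDualLattice_stdLattice_three_of_v hϖ⟩) + 1 ∧
        ∀ w ∈ (latticeGraph σ ϖ ((StdForm.antidiagonal 3).over K)).neighborSet c, latticeGraphIso σ ϖ ((StdForm.antidiagonal 3).over K) γ w = w} =
      {c | (latticeGraph σ ϖ ((StdForm.antidiagonal 3).over K)).Adj (latticeGraphIso σ ϖ ((StdForm.antidiagonal 3).over K) u ⟨stdLattice K 3, 0, isSelfDualLattice_stdLattice_three_of_v hϖ⟩) c ∧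
        (latticeGraph σ ϖ ((StdForm.antidiagonal 3).over K)).dist ⟨stdLattice K 3, 0, isSelfDualLattice_stdLattice_three_of_v hϖ⟩ c =
          (latticeGraph σ ϖ ((StdForm.antidiagonal 3).over K)).dist ⟨stdLattice K 3, 0, isSelfDualLattice_stdLattice_three_of_v hϖ⟩
            (latticeGraphIso σ ϖ ((StdForm.antidiagonal 3).over K) u ⟨stdLattice K 3, 0, isSelfDualLattice_stdLattice_three_of_v hϖ⟩) + 1} := by
    ext c
    simp only [Set.mem_setOf_eq]
    constructor
    · rintro ⟨hadj, hdc, -⟩; exact ⟨hadj, hdc⟩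
    · rintro ⟨hadj, hdc⟩
      obtain ⟨κ, hκK, hc⟩ := (mem_neighborSet_latticeGraphIso_root_iff hσ hvσ hσϖ hϖ h2 u c).1 hadj
      refine ⟨hadj, hdc, fun w hw => ?_⟩
      rw [hc] at hw
      exact forall_fixed_neighbor_of_congr_sq hvσ hσϖ hϖ hres hγK hκK hγϖ2 hw
  rw [hset]
  exact ncard_children_eq_of_isSelfDualLattice hσ hvσ hσϖ hϖ hres h2 hT hv hvr

/-! ## §4 The parent always passes: «the inward isotropic line of a fixed vertex is `Q_Ȳ`-null» -/

/-- **THE PARENT ALWAYS PASSES**: for `γ ∈ K₀` (so `γ` fixes the root `r = L₀`) and a fixed self-dual vertex `v ≠ r` with `(γ − 1)·v ⊆ ϖ·v`, the neighbours of `v` all of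
whose neighbours are fixed are the passing CHILDREN plus the PARENT: the grand-parent of `v` is fixed (★ `parentClosed_fixedPoints`), so one child of the parent's star
other than `v` is fixed and ★ G3 «one fixed ⇒ all fixed» applies — the rooted form of «the inward isotropic line is `Q_Ȳ`-null», giving `#{children passing} = ν − 1`
with `ν = #{neighbours passing}`. [cite: Serre1980Trees, I.2.3, II.1.1] [cite: Tits1979, §3.5] [cite: Kottwitz1986, §3] -/
theorem ncard_passingChildren_add_one_eq_ncard_passingNeighbors (hσ : ∀ x, σ (σ x) = x) (hvσ : ∀ a, Valued.v (σ a) = Valued.v a) (hσϖ : σ ϖ = -ϖ)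
    (hϖ : Valued.v ϖ = WithZero.exp (-1 : ℤ)) (hres : ∀ x : K, Valued.v x ≤ 1 → Valued.v (σ x - x) < 1) (h2 : Valued.v (2 : K) = 1) [Finite 𝓀[K]]
    (hT : (latticeGraph σ ϖ ((StdForm.antidiagonal 3).over K)).IsTree)
    {γ : unitaryGroupOfForm σ ((StdForm.antidiagonal 3).over K)} (hγ0 : γ ∈ unitaryInt σ ((StdForm.antidiagonal 3).over K))
    {v : {M : Submodule 𝒪[K] (Fin 3 → K) // IsVertex σ ϖ ((StdForm.antidiagonal 3).over K) M}}
    (hv : IsSelfDualLattice σ ϖ ((StdForm.antidiagonal 3).over K) v.1) (hvr : v ≠ ⟨stdLattice K 3, 0, isSelfDualLattice_stdLattice_three_of_v hϖ⟩)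
    (hfix : latticeGraphIso σ ϖ ((StdForm.antidiagonal 3).over K) γ v = v)
    (hlev : v.1.map ((Matrix.toLin' (((γ : GL (Fin 3) K) : Matrix (Fin 3) (Fin 3) K) - 1)).restrictScalars 𝒪[K]) ≤ scaleLattice ϖ v.1) :
    {c | (latticeGraph σ ϖ ((StdForm.antidiagonal 3).over K)).Adj v c ∧
        (latticeGraph σ ϖ ((StdForm.antidiagonal 3).over K)).dist ⟨stdLattice K 3, 0, isSelfDualLattice_stdLattice_three_of_v hϖ⟩ c =
          (latticeGraph σ ϖ ((StdForm.antidiagonal 3).over K)).dist ⟨stdLattice K 3, 0, isSelfDualLattice_stdLattice_three_of_v hϖ⟩ v + 1 ∧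
        ∀ w ∈ (latticeGraph σ ϖ ((StdForm.antidiagonal 3).over K)).neighborSet c, latticeGraphIso σ ϖ ((StdForm.antidiagonal 3).over K) γ w = w}.ncard + 1 =
      {c | c ∈ (latticeGraph σ ϖ ((StdForm.antidiagonal 3).over K)).neighborSet v ∧
        ∀ w ∈ (latticeGraph σ ϖ ((StdForm.antidiagonal 3).over K)).neighborSet c, latticeGraphIso σ ϖ ((StdForm.antidiagonal 3).over K) γ w = w}.ncard := by
  classical
  set G := latticeGraph σ ϖ ((StdForm.antidiagonal 3).over K) with hG
  set r : {M : Submodule 𝒪[K] (Fin 3 → K) // IsVertex σ ϖ ((StdForm.antidiagonal 3).over K) M} :=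
    ⟨stdLattice K 3, 0, isSelfDualLattice_stdLattice_three_of_v hϖ⟩ with hr
  have hϖ0 : ϖ ≠ 0 := uniformizer_ne_zero hϖ
  obtain ⟨p, hpar, hchild, -, -⟩ := exists_rooted_parent hT r
  -- `γ` fixes the root, so its fixed set is parent-closed
  have hγr : latticeGraphIso σ ϖ ((StdForm.antidiagonal 3).over K) γ r = r :=
    Subtype.ext (by rw [latticeGraphIso_apply_val]; exact mapGL_stdLattice_of_mem_unitaryInt hγ0)
  have hPC := parentClosed_fixedPoints hT r (latticeGraphIso σ ϖ ((StdForm.antidiagonal 3).over K) γ) hγr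
  -- `v = u·L₀`
  obtain ⟨u, hu⟩ := exists_latticeGraphIso_root_eq_of_v_two hσ hvσ hϖ h2 v hv (isSelfDualLattice_stdLattice_three_of_v hϖ)
  subst hu
  have hvr' : latticeGraphIso σ ϖ ((StdForm.antidiagonal 3).over K) u r ≠ r := hvr
  have hγK : u⁻¹ * γ * u ∈ unitaryInt σ ((StdForm.antidiagonal 3).over K) := mem_unitaryInt_conj_of_latticeGraphIso_apply_root_eq hfix
  have hγϖ : ∀ i j, Valued.v (((((u⁻¹ * γ * u : unitaryGroupOfForm σ ((StdForm.antidiagonal 3).over K)) : GL (Fin 3) K) : Matrix (Fin 3) (Fin 3) K) - 1) i j) ≤ Valued.v ϖ :=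
    (forall_v_conj_sub_one_le_iff_map_sub_one_le_scaleLattice γ u hϖ0).1 hlev
  -- the parent `p v`, a modular neighbour `(uκ)·N₁`, is fixed, is not the root, and its own parent (the grand-parent of `v`) is fixed and `≠ v`
  obtain ⟨hpadj, hpdist⟩ := hpar _ hvr'
  have hpfix : latticeGraphIso σ ϖ ((StdForm.antidiagonal 3).over K) γ (p (latticeGraphIso σ ϖ ((StdForm.antidiagonal 3).over K) u r)) =
      p (latticeGraphIso σ ϖ ((StdForm.antidiagonal 3).over K) u r) := hPC _ hfix hvr' _ hpadj hpdist
  obtain ⟨κ, hκK, hpκ⟩ := (mem_neighborSet_latticeGraphIso_root_iff hσ hvσ hσϖ hϖ h2 u _).1 ((SimpleGraph.mem_neighborSet _ _ _).2 hpadj)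
  have hpr : p (latticeGraphIso σ ϖ ((StdForm.antidiagonal 3).over K) u r) ≠ r := by
    intro hpr
    have h2type : IsVertexLattice σ ϖ ((StdForm.antidiagonal 3).over K) 2 (p (latticeGraphIso σ ϖ ((StdForm.antidiagonal 3).over K) u r)).1 := by
      rw [hpκ, latticeGraphIso_apply_val]
      exact isVertexLattice_mapGL σ ϖ _ _ (u * κ).2 (isVertexLattice_two_N₁_of_neg hσϖ hϖ)
    rw [hpr] at h2type
    exact not_isSelfDualLattice_of_isVertexLattice_two_of_v hvσ hϖ h2type (isSelfDualLattice_stdLattice_three_of_v hϖ)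
  obtain ⟨hppadj, hppdist⟩ := hpar _ hpr
  have hppfix := hPC _ hpfix hpr _ hppadj hppdist
  have hppne : p (p (latticeGraphIso σ ϖ ((StdForm.antidiagonal 3).over K) u r)) ≠ latticeGraphIso σ ϖ ((StdForm.antidiagonal 3).over K) u r := by
    intro heq
    rw [heq] at hppdist
    omega
  -- hence the parent passes
  have hppass : ∀ w ∈ G.neighborSet (p (latticeGraphIso σ ϖ ((StdForm.antidiagonal 3).over K) u r)), latticeGraphIso σ ϖ ((StdForm.antidiagonal 3).over K) γ w = w := by
    intro w hw
    rw [hpκ] at hw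
    refine (latticeGraphIso_eq_iff_mapGL_eq γ w).2
      (forall_mapGL_eq_self_of_exists_fixed_child_latticeGraphIso_of_congr hvσ hσϖ hϖ hres hγK hκK hγϖ ⟨p (p (latticeGraphIso σ ϖ ((StdForm.antidiagonal 3).over K) u r)), ?_, ?_, ?_⟩ hw)
    · rw [← hpκ]; exact (SimpleGraph.mem_neighborSet _ _ _).2 hppadj
    · intro heq
      exact hppne (Subtype.ext (by rw [latticeGraphIso_apply_val]; exact heq))
    · exact (latticeGraphIso_eq_iff_mapGL_eq γ _).1 hppfix
  -- the passing neighbours = the parent plus the passing children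
  have hfinv : (G.neighborSet (latticeGraphIso σ ϖ ((StdForm.antidiagonal 3).over K) u r)).Finite := by
    refine Set.finite_of_ncard_ne_zero ?_
    rw [ncard_neighborSet_latticeGraphIso, ncard_neighborSet_root_of_ramified hσ hvσ hϖ hres h2 (isVertexLattice_two_N₁_of_neg hσϖ hϖ)]
    exact Nat.succ_ne_zero _
  have hset : {c | c ∈ G.neighborSet (latticeGraphIso σ ϖ ((StdForm.antidiagonal 3).over K) u r) ∧ ∀ w ∈ G.neighborSet c, latticeGraphIso σ ϖ ((StdForm.antidiagonal 3).over K) γ w = w} =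
      insert (p (latticeGraphIso σ ϖ ((StdForm.antidiagonal 3).over K) u r))
        {c | G.Adj (latticeGraphIso σ ϖ ((StdForm.antidiagonal 3).over K) u r) c ∧ G.dist r c = G.dist r (latticeGraphIso σ ϖ ((StdForm.antidiagonal 3).over K) u r) + 1 ∧
          ∀ w ∈ G.neighborSet c, latticeGraphIso σ ϖ ((StdForm.antidiagonal 3).over K) γ w = w} := by
    ext c
    simp only [Set.mem_setOf_eq, Set.mem_insert_iff, SimpleGraph.mem_neighborSet]
    constructor
    · rintro ⟨hadj, hpass⟩
      by_cases hcp : c = p (latticeGraphIso σ ϖ ((StdForm.antidiagonal 3).over K) u r)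
      · exact Or.inl hcp
      · exact Or.inr ⟨hadj, (hchild _ c hvr' hadj hcp).1, hpass⟩
    · rintro (hcp | ⟨hadj, -, hpass⟩)
      · rw [hcp]
        exact ⟨hpadj, fun w hw => hppass w ((SimpleGraph.mem_neighborSet _ _ _).2 hw)⟩
      · exact ⟨hadj, hpass⟩
  have hnotmem : p (latticeGraphIso σ ϖ ((StdForm.antidiagonal 3).over K) u r) ∉
      {c | G.Adj (latticeGraphIso σ ϖ ((StdForm.antidiagonal 3).over K) u r) c ∧ G.dist r c = G.dist r (latticeGraphIso σ ϖ ((StdForm.antidiagonal 3).over K) u r) + 1 ∧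
        ∀ w ∈ G.neighborSet c, latticeGraphIso σ ϖ ((StdForm.antidiagonal 3).over K) γ w = w} := by
    rintro ⟨-, hdc, -⟩
    omega
  have hfinC : {c | G.Adj (latticeGraphIso σ ϖ ((StdForm.antidiagonal 3).over K) u r) c ∧ G.dist r c = G.dist r (latticeGraphIso σ ϖ ((StdForm.antidiagonal 3).over K) u r) + 1 ∧
        ∀ w ∈ G.neighborSet c, latticeGraphIso σ ϖ ((StdForm.antidiagonal 3).over K) γ w = w}.Finite :=
    hfinv.subset (fun c hc => hc.1)
  rw [hset, Set.ncard_insert_of_notMem hnotmem hfinC]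

end Three

end Literature.NumberTheory.Automorphic.UnitaryLatticeTree

end
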